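import Summits.ValiantsHypothesis.ValiantsHypothesis.Theorems.TwistedDetRankFermionicNormalFormSummitHard

/-! Census exhibit (Transfer heading): on the block-swap test permutations the SIGN PATTERN factorises,
`sgn σ_{x,y} = ε · sgn(π_x) · sgn(c π_y)`, i.e. the flattened sign matrix is rank one, so every
sign-rank transfer of the exact flattening (`two_pow_le_of_repr`, `two_pow_le_succ_of_repr`) is blind:
the sign-rank of a rank-one sign pattern is 1. -/

set_option linter.dupNamespace false

namespace Summit.ValiantsHypothesis.ValiantsHypothesis.Theorems.TwistedDetRankFermionicNormalForm

open Equiv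

theorem sign_testPerm_factorises {k : ℕ} (x y : Fin (k + 1) → Bool) :
    Perm.sign (testPerm x y) =
      Perm.sign (Equiv.sumComm (Fin (2 * k + 2)) (Fin (2 * k + 2)) : Perm (Fin (2 * k + 2) ⊕ Fin (2 * k + 2)))
        * Perm.sign (pairSwap x) * Perm.sign (finRotate (2 * k + 2) * pairSwap y) := by
  rw [testPerm, Perm.sign_permCongr, sign_swapPerm]

/-- Hence a ONE-term "representation" already matches the sign pattern on every test permutation:
with `u x := ε · sgn π_x`, `v y := sgn (c π_y)` we have `sgn σ_{x,y} · (u x * v y) = 1 > 0`. -/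
theorem testPerm_signPattern_rank_one {k : ℕ} (x y : Fin (k + 1) → Bool) :
    0 < ((Perm.sign (testPerm x y) : ℤ) : ℝ) *
      ((((Perm.sign (Equiv.sumComm (Fin (2 * k + 2)) (Fin (2 * k + 2)) :
          Perm (Fin (2 * k + 2) ⊕ Fin (2 * k + 2))) * Perm.sign (pairSwap x) : ℤˣ) : ℤ) : ℝ) *
        (((Perm.sign (finRotate (2 * k + 2) * pairSwap y) : ℤ) : ℝ))) := by
  rw [sign_testPerm_factorises]
  push_cast
  rcases Int.units_eq_one_or (Perm.sign (Equiv.sumComm (Fin (2 * k + 2)) (Fin (2 * k + 2)) :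
      Perm (Fin (2 * k + 2) ⊕ Fin (2 * k + 2)))) with h₁ | h₁ <;>
  rcases Int.units_eq_one_or (Perm.sign (pairSwap x)) with h₂ | h₂ <;>
  rcases Int.units_eq_one_or (Perm.sign (finRotate (2 * k + 2) * pairSwap y)) with h₃ | h₃ <;>
  simp [h₁, h₂, h₃]

end Summit.ValiantsHypothesis.ValiantsHypothesis.Theorems.TwistedDetRankFermionicNormalForm
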